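import Summits.BirchSwinnertonDyer.Rank1Residual.GaloisImage.SmallImageNiveauDichotomy
import Literature.NumberTheory.SerreUniformity.SplitCartan
import HarnessLib

/-!
# Image `3Ns ⟹ e₃ = 2` (`InertiaSplitAt`), and the O8 / small-image class forms of the `p = 3`
# dichotomy `e₃ ∈ {2, 8}` and of the cyclic tame generator — part 6c of the O8-TAME kernel theorems
# (cell `b2b-bsdres`, lane CLASS-CLOSURE, seat cc-typer-1 = typer of record N11 / O8;
# `class-closure/O8/STATEMENT.md` §19, `O8/SUBPARTITION-typed.md` v1.8, census shadow NIV3)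

HONEST FRAMING (cell `b2b-bsdres`, run/shared/lean/b2b/bsd-rank1-residual/, verbatim in every
file): the goal of the cell is to DELETE the COMBINATION-SHAPED residual classes of the
Birch–Swinnerton-Dyer formula for ALL analytic-rank `≤ 1` elliptic curves over `ℚ` — "full BSD
formula for every rank `≤ 1` curve in class `C`" assembled STRICTLY from published theorems — so
that the rank-`≤ 1` remainder becomes exactly the CONSTRUCTION-SHAPED classes, which are TYPED
(missing-input `Prop`s), NOT attempted. This is not "finishing BSD". Lane CLASS-CLOSURE: research
routes, no claim beyond the stated classes; census output = EVIDENCE, never a Literature fact;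
NOTHING is booked here. THEOREMS ONLY; no definition, no named fact, no conjecture, no `sorry`.

## What is proved

* §3 `galoisRepTorsion_pow_four_eq_one_of_hasSplitCartanNormalizerModPImage_three` — a mod-`3`
  image inside the normaliser of a split Cartan subgroup (`SerreUniformity.HasSplitCartanNormalizerModPImage W 3`,
  obsanat's `3Ns`) acts on `E[3]` through elements of exponent `4`
  (`GL2F3Cyc.pow_four_eq_one_of_mem_splitCartanNormalizer_three`); hence
  `inertiaSplitAt_three_of_hasSplitCartanNormalizerModPImage` — **`3Ns` and `3 ∤ e₃ ⟹ e₃ = 2 ∧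
  InertiaSplitAt W 3 I_𝔓`** (part 6b's dichotomy excludes `e₃ = 8`).
* §4 small-image / O8 forms (`Irr W p ∧ ¬ Surj W p ⟹ p ∤ e_p`, part 4):
  `card_inertia_map_three_eq_two_or_eq_eight_of_irr_of_not_surj`;
  `O8.card_inertia_map_three_eq_two_or_eq_eight` (ALL 1 334 O8 rows at `3` — (M), `I₀*`,
  potentially supersingular tame AND wild: `e₃ = 2 ∧ InertiaSplitAt`, or `e₃ = 8 ∧` no stable line);
  `O8.inertiaSplitAt_three_of_hasSplitCartanNormalizerModPImage` (the 424 `3Ns` rows of O8, 226 of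
  them potentially supersingular with conductor exponent `3`: TAME-SPLIT with no twist model and no
  Tate fact); `O8.isCyclic_inertia_map_galoisRepTorsion`, `O8.exists_generator_inertia_smul` (every `p`).

READING (class-closure): O8's rows at the additive prime split THEOREM-LEVEL into NIVEAU 1
(`e₃ = 2`, `E[3]|_I ≅ ω ⊕ 1`: all `3Ns` rows, all (M)/`I₀*` rows, and whichever `3Nn` potentially
supersingular rows the census finds) and NIVEAU 2 (`e₃ = 8`, `E[3]|_I` irreducible — every
ordinary-type local hypothesis fails there, the "`ρ̄|_{G_p}` irreducible" hypothesis of the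
non-ordinary literature holds); the census shadow NIV3 decides the split per row.  Nothing about
BSD_p; O8 / N2 / N3 stay OPEN; nothing is booked.

References: J.-P. Serre, Invent. Math. 15 (1972) §1.3–§1.11, §2.4 Prop. 15 [Serre1972];
Bilu–Parent–Rebolledo (2013) §1 [BiluParentRebolledo2013]; class-closure/O8/STATEMENT.md §§12–19.
-/

noncomputable section

open scoped Classical NumberField Pointwise
open Field IsDedekindDomain WeierstrassCurve

namespace Summit.BirchSwinnertonDyer.Rank1Residual.GaloisImage

open Literature.NumberTheory.EllipticCurves Literature.NumberTheory.GaloisRepresentations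
  Rat.HeightOneSpectrum NumberField
  Literature.NumberTheory.EllipticCurves.Rank1Residual
  Summit.BirchSwinnertonDyer.Rank1Residual.Additive.MixedCongruence

section Three

variable {W : WeierstrassCurve ℚ} [W.IsElliptic]

/-! ## §3. Image `3Ns` ⟹ `e₃ = 2` -/

omit [W.IsElliptic] in
/-- **Mod-`3` image in the normaliser of a split Cartan ⟹ `ρ̄(σ)⁴ = 1` for every `σ`** (that
normaliser has exponent `4` in `GL₂(𝔽₃)`). [cite: BiluParentRebolledo2013, §1 (after Cor. 1.2)] -/
theorem galoisRepTorsion_pow_four_eq_one_of_hasSplitCartanNormalizerModPImage_three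
    (h : Literature.NumberTheory.SerreUniformity.HasSplitCartanNormalizerModPImage W 3)
    (σ : absoluteGaloisGroup ℚ) : galoisRepTorsion W ((3 : ℕ) : ℤ) σ ^ 4 = 1 := by
  obtain ⟨e, himg⟩ := h
  obtain ⟨M, hM, hσ⟩ := himg σ
  have hM4 := GL2F3Cyc.pow_four_eq_one_of_mem_splitCartanNormalizer_three hM
  rw [← map_pow, galoisRepTorsion_eq_one_iff' W _ (σ ^ 4)]
  intro P
  have hiter : ∀ n : ℕ, ∀ P : geomTorsion W ((3 : ℕ) : ℤ), e (σ ^ n • P) = (M ^ n).mulVec (e P) := by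
    intro n
    induction n with
    | zero => intro P; simp
    | succ n ih =>
      intro P
      rw [pow_succ, mul_smul, ih (σ • P), hσ P, Matrix.mulVec_mulVec, ← pow_succ]
  apply e.injective
  rw [hiter 4 P, hM4, Matrix.one_mulVec]

/-- **Image `3Ns` and `3 ∤ e₃ ⟹ e₃ = 2 ∧ InertiaSplitAt W 3 I_𝔓`** — every `3Ns` row of O8
(424 rows, incl. the 226 potentially supersingular rows with wild conductor exponent) is TAME-SPLIT
at `3`, with no twist model and no Tate fact. [cite: Serre1972, §1.3–§1.11, §2.4 Prop. 15]
[cite: BiluParentRebolledo2013, §1 (after Cor. 1.2)] -/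
theorem inertiaSplitAt_three_of_hasSplitCartanNormalizerModPImage {p : ℕ} [Fact p.Prime]
    (hp3 : p = 3) (h : Literature.NumberTheory.SerreUniformity.HasSplitCartanNormalizerModPImage W 3)
    {v : HeightOneSpectrum (𝓞 ℚ)} (hv : ((p : ℕ) : 𝓞 ℚ) ∈ v.asIdeal)
    {𝔓 : Ideal (absIntegers (𝓞 ℚ) ℚ)} (h𝔓 : 𝔓 ∈ v.primesAbove)
    (hI : ¬ p ∣ Nat.card ((𝔓.inertia (absoluteGaloisGroup ℚ)).map (galoisRepTorsion W p))) :
    Nat.card ((𝔓.inertia (absoluteGaloisGroup ℚ)).map (galoisRepTorsion W p)) = 2 ∧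
      InertiaSplitAt W p (𝔓.inertia (absoluteGaloisGroup ℚ)) := by
  rcases card_inertia_map_three_eq_two_or_eq_eight (W := W) hp3 hv h𝔓 hI with h2 | ⟨h8, -⟩
  · exact h2
  · exfalso
    subst hp3
    obtain ⟨s, -, -, hcard⟩ := exists_card_inertia_map_eq_orderOf_of_not_dvd_card hv h𝔓 hI
    have h4 : orderOf (galoisRepTorsion W ((3 : ℕ) : ℤ) s) ∣ 4 := orderOf_dvd_of_pow_eq_one
      (galoisRepTorsion_pow_four_eq_one_of_hasSplitCartanNormalizerModPImage_three h s)
    rw [← hcard, h8] at h4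
    norm_num at h4

/-! ## §4. Small-image / O8 packaging -/

/-- **Small image at `3` ⟹ the dichotomy**: `Irr W 3 ∧ ¬ Surj W 3 ⟹ (e₃ = 2 ∧ InertiaSplitAt) ∨
(e₃ = 8 ∧` niveau 2`)` — every O8 row at `3` (all 1 334, any reduction type) and every N2 row.
[cite: Serre1972, §1.3–§1.11, §2.4 Prop. 15] -/
theorem card_inertia_map_three_eq_two_or_eq_eight_of_irr_of_not_surj {p : ℕ} [Fact p.Prime]
    (hp3 : p = 3) (hirr : Irr W p) (hns : ¬ Surj W p)
    {v : HeightOneSpectrum (𝓞 ℚ)} (hv : ((p : ℕ) : 𝓞 ℚ) ∈ v.asIdeal)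
    {𝔓 : Ideal (absIntegers (𝓞 ℚ) ℚ)} (h𝔓 : 𝔓 ∈ v.primesAbove) :
    (Nat.card ((𝔓.inertia (absoluteGaloisGroup ℚ)).map (galoisRepTorsion W p)) = 2 ∧
        InertiaSplitAt W p (𝔓.inertia (absoluteGaloisGroup ℚ))) ∨
      (Nat.card ((𝔓.inertia (absoluteGaloisGroup ℚ)).map (galoisRepTorsion W p)) = 8 ∧
        ¬ ∃ L : AddSubgroup (geomTorsion W (p : ℤ)), Nat.card L = p ∧
          ∀ σ ∈ 𝔓.inertia (absoluteGaloisGroup ℚ), ∀ P ∈ L, σ • P ∈ L) :=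
  card_inertia_map_three_eq_two_or_eq_eight hp3 hv h𝔓
    (not_dvd_card_map_galoisRepTorsion_of_irr_of_not_surj W p hirr hns _)

end Three

end Summit.BirchSwinnertonDyer.Rank1Residual.GaloisImage

/-! ## §4 (continued). O8 forms -/

namespace Summit.BirchSwinnertonDyer.Rank1Residual.Additive

open Summit.BirchSwinnertonDyer.Rank1Residual.GaloisImage
open Literature.NumberTheory.EllipticCurves Literature.NumberTheory.GaloisRepresentations
  Literature.NumberTheory.EllipticCurves.Rank1Residual
  Summit.BirchSwinnertonDyer.Rank1Residual.Additive.MixedCongruence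
open scoped NumberField

variable (W : WeierstrassCurve ℚ) [W.IsElliptic] (p : ℕ) [Fact p.Prime]

/-- **O8 ⟹ `ρ̄_{E,p}(I_𝔓)` is CYCLIC of order prime to `p`** (every `p`, every reduction type at
`p`). [cite: Serre1972, §2.4 Prop. 15] [cite: SerreLocalFields1979, Ch. IV §2 Prop. 7, Cor. 1 and Cor. 3] -/
theorem O8.isCyclic_inertia_map_galoisRepTorsion (hX : ClassX4 W p) (hns : ¬ Surj W p)
    {v : HeightOneSpectrum (𝓞 ℚ)} (hv : ((p : ℕ) : 𝓞 ℚ) ∈ v.asIdeal)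
    {𝔓 : Ideal (absIntegers (𝓞 ℚ) ℚ)} (h𝔓 : 𝔓 ∈ v.primesAbove) :
    IsCyclic ((𝔓.inertia (absoluteGaloisGroup ℚ)).map (galoisRepTorsion W p)) :=
  isCyclic_inertia_map_galoisRepTorsion_of_irr_of_not_surj hX.2.2 hns hv h𝔓

/-- **O8 ⟹ one tame generator**: every `x ∈ I_𝔓` acts on `E[p]` as a power of one `s ∈ I_𝔓`.
[cite: Serre1972, §2.4 Prop. 15] [cite: SerreLocalFields1979, Ch. IV §2 Prop. 7, Cor. 1 and Cor. 3] -/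
theorem O8.exists_generator_inertia_smul (hX : ClassX4 W p) (hns : ¬ Surj W p)
    {v : HeightOneSpectrum (𝓞 ℚ)} (hv : ((p : ℕ) : 𝓞 ℚ) ∈ v.asIdeal)
    {𝔓 : Ideal (absIntegers (𝓞 ℚ) ℚ)} (h𝔓 : 𝔓 ∈ v.primesAbove) :
    ∃ s ∈ 𝔓.inertia (absoluteGaloisGroup ℚ), ∀ x ∈ 𝔓.inertia (absoluteGaloisGroup ℚ),
      ∃ k : ℤ, ∀ P : geomTorsion W (p : ℤ), x • P = s ^ k • P :=
  exists_generator_inertia_smul_of_irr_of_not_surj hX.2.2 hns hv h𝔓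

/-- **O8 at `3` ⟹ `e₃ = 2 ∧ InertiaSplitAt`, or `e₃ = 8 ∧` no stable line** (all 1 334 O8 rows at
`p = 3`: (M), `I₀*`, potentially supersingular tame AND wild). [cite: Serre1972, §1.3–§1.11, §2.4 Prop. 15] -/
theorem O8.card_inertia_map_three_eq_two_or_eq_eight (hp3 : p = 3) (hX : ClassX4 W p) (hns : ¬ Surj W p)
    {v : HeightOneSpectrum (𝓞 ℚ)} (hv : ((p : ℕ) : 𝓞 ℚ) ∈ v.asIdeal)
    {𝔓 : Ideal (absIntegers (𝓞 ℚ) ℚ)} (h𝔓 : 𝔓 ∈ v.primesAbove) :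
    (Nat.card ((𝔓.inertia (absoluteGaloisGroup ℚ)).map (galoisRepTorsion W p)) = 2 ∧
        InertiaSplitAt W p (𝔓.inertia (absoluteGaloisGroup ℚ))) ∨
      (Nat.card ((𝔓.inertia (absoluteGaloisGroup ℚ)).map (galoisRepTorsion W p)) = 8 ∧
        ¬ ∃ L : AddSubgroup (geomTorsion W (p : ℤ)), Nat.card L = p ∧
          ∀ σ ∈ 𝔓.inertia (absoluteGaloisGroup ℚ), ∀ P ∈ L, σ • P ∈ L) :=
  card_inertia_map_three_eq_two_or_eq_eight_of_irr_of_not_surj hp3 hX.2.2 hns hv h𝔓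

/-- **O8 ∩ 3Ns ⟹ `e₃ = 2 ∧ InertiaSplitAt W 3 I_𝔓`** (the 424 `3Ns` rows of O8, 226 of them
potentially supersingular with conductor exponent `3`): TAME-SPLIT with no twist model.
[cite: Serre1972, §1.3–§1.11, §2.4 Prop. 15] [cite: BiluParentRebolledo2013, §1 (after Cor. 1.2)] -/
theorem O8.inertiaSplitAt_three_of_hasSplitCartanNormalizerModPImage (hp3 : p = 3) (hX : ClassX4 W p)
    (hns : ¬ Surj W p) (h : Literature.NumberTheory.SerreUniformity.HasSplitCartanNormalizerModPImage W 3)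
    {v : HeightOneSpectrum (𝓞 ℚ)} (hv : ((p : ℕ) : 𝓞 ℚ) ∈ v.asIdeal)
    {𝔓 : Ideal (absIntegers (𝓞 ℚ) ℚ)} (h𝔓 : 𝔓 ∈ v.primesAbove) :
    Nat.card ((𝔓.inertia (absoluteGaloisGroup ℚ)).map (galoisRepTorsion W p)) = 2 ∧
      InertiaSplitAt W p (𝔓.inertia (absoluteGaloisGroup ℚ)) :=
  GaloisImage.inertiaSplitAt_three_of_hasSplitCartanNormalizerModPImage hp3 h hv h𝔓
    (not_dvd_card_map_galoisRepTorsion_of_irr_of_not_surj W p hX.2.2 hns _)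

end Summit.BirchSwinnertonDyer.Rank1Residual.Additive

end
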